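import Literature.MathematicalPhysics.QuantumFieldTheory.Balaban1983to89.B8Eq1101CubeMemberRealGrad

/-!
# `Balaban1983to89.B8Eq1101CubeMemberWeights` — THE PRINTED WEIGHTS of the flat Dirichlet multi-level matrix on the cube member and [Balaban1985RegularSpaces]
# (1.101) = REAL-1 of `B8Prop6CubeMemberFlatScalar.prop6_cubeMember_flat_of_real` WITH NO WEIGHT HYPOTHESIS LEFT
# ([Balaban1984PropagatorsII] (2.14) p. 225 «a_{j+1} = aa_j∕(aL⁻² + a_j), a₁ = a»; [Balaban1985BackgroundPropagators] Theorem 3.1 p. 397 at `U = 1`)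

statement-level skeleton of published theorems with citation tags; proofs where landed; nothing here is a claim about the
Yang–Mills mass gap

`[Balaban1985RegularSpaces]` ("B8") (1.101) p. 93, (1.91) p. 91, p. 98, (1.131) p. 99; `[Balaban1984PropagatorsII]` ("B6") (2.13)–(2.14) p. 225, Prop. 2.2 (2.67)
p. 234; `[Balaban1982Higgs1]` (2.15) p. 609 (the window of the weight sequence).  PDF held: `paper:balaban1985-cmp99-regular-spaces-gauge-fixing`.

CITATION HEADER (lean-in-tree rule).  Cell `pub-ymgap` (YM Track A, HUMAN RULING D-0062), DAG node N05 = [B8], seat `pub-ymgap-dag-n05-c` (g9; (R1′)-v2 HYBRID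
route, file F4e).  F4d `B8Eq1101CubeMemberRealGrad.ineq1101_cubeMember_real` proves the complete REAL-1 family for every consumer weight sequence `w` tied to a p21
weight sequence `a` in the window `[4, 8]` with the recursion `a_{i+1} = aNext ℓ a_i c_i`.  The consumer's `w` is FREE (`prop6_cubeMember_flat_of_real` quantifies
`∀ w ≥ 0`), so the knit must CHOOSE one; THIS FILE fixes the canonical choice — p21's printed sequence `aPrinted ℓ 8` (`a₁ = 8`, window `[8(1−L⁻²), 8] ⊂ [4, 8]` for
`L ≥ 2`) completed by `a₀ = 8` at the unit level, and `w_j = η⁻²·levC_j·L^{2(d+1)j}` (`= η⁻²a_jL^{(d−1)j}`, `w₀ = 8η⁻²`) — verifies every weight hypothesis of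
F4d once and for all, and restates REAL-1 with NO weight hypothesis left.

WHAT THIS FILE PROVES (kernel-checked).
* §1 `awPrinted` (def), `wPrinted` (def), `awPrinted_facts` (window `[4,8]` for `j ≥ 1`, positivity for all `j`, `a₀ = 8`, recursion with `c ≡ 8` —
  p21's `aPrinted_window` ∕ `aPrinted_succ`), `wPrinted_facts` (positivity; the relation `w_j·L^{−2(d+1)j} = η⁻²·levC_j`; the normalised weight
  `w_jη²L^{2j}L^{−(d+1)j} = a_j`).
* §3 (v1.1, append-only) `admissibleData_exists` — the side conditions on `(M_h, R, ρ, M)` are jointly satisfiable for every `ℓ, M₀, ρ₀, N₀` (non-vacuity).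
* §2 ★★★ `ineq1101_cubeMember_real_printed` — F4d's theorem at these weights: `∃ B_G ρ₀ M₀ N₀` (of `d, ℓ`) such that for `η > 0`, `M_h ≥ 3` with `M₀ ≤ L·M_h`, every
  cube datum and truncation with `M_hL ∣ ρ`, `M_hL ∣ M`, `R·M_hL ≤ ρ`, `2L ≤ R`, `N₀ + 1 ≤ R·L·M_h`, `ρ₀ ≤ ρ`, the consumer's explicit matrix `T = Matrix.of K` at the
  weights `wPrinted d ℓ η`, every source with `wt(j)²|ρ′| ≤ r` on `□_j` and `φ = T⁻¹ρ′` extended by zero: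
  `(∀ x, |φ x| ≤ B_G r) ∧ (∀ j ≤ n, ∀ p ∈ {b | SideTouches □_j b.1 b.2}, wt (ℓ+1) η j * |η⁻¹(φ(p.1 + e p.2) − φ p.1)| ≤ B_G r)`.

HONEST SCOPE ∕ NOT CLAIMED.  A choice of weights and a specialisation; no new estimate.  As F4c∕F4d: the data stay on print's big-block sub-lattice with `R₁M₁` large
(the consumer quantifies `∀ M ρ`, `L ≤ ρ ≤ M`); `L = ℓ + 1`, dimension `d + 1`; constants existential; REAL-2∕REAL-3 untouched.  Count-neutral; N05 NOT discharged;
one finite `T⁴` programme at fixed `ε`, Bałaban as printed; nothing continuum ∕ ℝ⁴ ∕ OS ∕ mass-gap ∕ Clay.  No `sorry`, no `instance`, no `notation`; two `def`s.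
Unit `pub-ymgap-dag-n05-c` (g9), 2026-08-27.

RELATED IN THE TREE, NOT DUPLICATED: `B6MultiLevelBoxOperator.aPrinted` ∕ `aPrinted_window` ∕ `aPrinted_succ` (p21, USED), `B8Eq1101CubeMemberRealGrad.ineq1101_cubeMember_real`
(F4d, USED), `B8Prop6CubeMemberFlatScalar.*` (the consumer).
-/
noncomputable section

namespace Literature.MathematicalPhysics.QuantumFieldTheory.Balaban1983to89.B8Eq1101CubeMemberWeights

open scoped Matrix
open B6MultiLevelBoxOperator (N0 levC aPrinted aPrinted_window aPrinted_succ)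
open B6Ineq243TwoLevelBox (aNext)
open B4Reflection242 (boxDom)
open B7Prop1Explicit (e)
open B8Eq131CubesAdmissible (cubeFam)
open B8CubeMemberZd (cubeLamS)
open B8LambdaSpaceKLevel (wt)
open B8Eq140Level (SideTouches)
open B8Eq1101CubeMemberRealGrad (ineq1101_cubeMember_real)
open Literature.MathematicalPhysics.QuantumLattice (blockMap)

variable {d : ℕ}

/-! ## §1 The weights -/

/-- p21's printed sequence `a_j = B1.aSeq 8 L j` (`j ≥ 1`, `a₁ = 8`) completed by `a₀ = 8` at the unit level (print's (2.14) leaves `a₀` free; any value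
in the window serves). [cite: Balaban1984PropagatorsII, (2.14) p.225] -/
def awPrinted (ℓ : ℕ) (j : ℕ) : ℝ := if j = 0 then 8 else aPrinted ℓ 8 j

/-- The consumer's weights `w_j = η⁻²·levC_j·L^{2(d+1)j}` (= `η⁻²a_jL^{(d−1)j}`; `w₀ = 8η⁻²`): the free weights of `prop6_cubeMember_flat_of_real` chosen so that
the flat Dirichlet matrix has p21's rows inside `□₁` (F2 `row_eq_mlOp_row`). [cite: Balaban1984PropagatorsII, (2.13)–(2.14) p.225; Balaban1985RegularSpaces, (1.91) p.91] -/
def wPrinted (d ℓ : ℕ) (η : ℝ) (j : ℕ) : ℝ :=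
  (η ^ 2)⁻¹ * levC d ℓ (awPrinted ℓ) j * (((((ℓ + 1 : ℕ) : ℝ)) ^ (d + 1)) ^ j) ^ 2

/-- Window and positivity of the completed printed sequence: `4 ≤ a_j ≤ 8` for `j ≥ 1` (`L ≥ 2`), `a₀ = 8`, `a_j > 0`. [cite: Balaban1984PropagatorsII, (2.14) p.225; Balaban1982Higgs1, (2.15) p.609] -/
theorem awPrinted_facts {ℓ : ℕ} (hℓ : 1 ≤ ℓ) :
    (∀ j, 1 ≤ j → 4 ≤ awPrinted ℓ j ∧ awPrinted ℓ j ≤ 8) ∧ (∀ j, 0 < awPrinted ℓ j) ∧ awPrinted ℓ 0 = 8 ∧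
    (∀ j, 1 ≤ j → awPrinted ℓ (j + 1) = aNext ℓ (awPrinted ℓ j) 8) := by
  have h1ℓ : (1 : ℝ) ≤ ℓ := by exact_mod_cast hℓ
  have hL2 : (2 : ℝ) ≤ (ℓ : ℝ) + 1 := by linarith
  have hwin : ∀ j, 1 ≤ j → 4 ≤ awPrinted ℓ j ∧ awPrinted ℓ j ≤ 8 := by
    intro j hj
    obtain ⟨h1, h2, -⟩ := aPrinted_window hℓ (by norm_num : (0 : ℝ) < 8) hj
    have hj0 : j ≠ 0 := by omega
    unfold awPrinted; rw [if_neg hj0]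
    refine ⟨le_trans ?_ h1, h2⟩
    -- `8(1 − 1/L²) ≥ 4` for `L ≥ 2`
    have hsq : (4 : ℝ) ≤ ((ℓ : ℝ) + 1) ^ 2 := by nlinarith
    have hinv : (((ℓ : ℝ) + 1) ^ 2)⁻¹ ≤ 1 / 2 := by
      rw [inv_le_comm₀ (by positivity) (by norm_num)]; linarith
    nlinarith
  refine ⟨hwin, fun j => ?_, by simp [awPrinted], fun j hj => ?_⟩
  · by_cases hj : j = 0
    · subst hj; simp [awPrinted]
    · exact lt_of_lt_of_le (by norm_num) (hwin j (Nat.one_le_iff_ne_zero.mpr hj)).1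
  · have hj0 : j ≠ 0 := by omega
    unfold awPrinted
    rw [if_neg (by omega : j + 1 ≠ 0), if_neg hj0]
    exact aPrinted_succ hℓ (by norm_num) hj

/-- The weights are positive and satisfy the relation `w_j·L^{−2(d+1)j} = η⁻²·levC_j` and the window `a′_j = w_jη²L^{2j}L^{−(d+1)j} ∈ [4, 8]`.
[cite: Balaban1984PropagatorsII, (2.13)–(2.14) p.225; Balaban1985RegularSpaces, (1.91) p.91] -/
theorem wPrinted_facts (d : ℕ) {ℓ : ℕ} (hℓ : 1 ≤ ℓ) {η : ℝ} (hη : 0 < η) :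
    (∀ j, 0 < wPrinted d ℓ η j) ∧
    (∀ j, wPrinted d ℓ η j * (((((ℓ + 1 : ℕ) : ℝ) ^ (d + 1))⁻¹) ^ j) ^ 2 = (η ^ 2)⁻¹ * levC d ℓ (awPrinted ℓ) j) ∧
    (∀ j, wPrinted d ℓ η j * η ^ 2 * (((ℓ + 1 : ℕ) : ℝ) ^ j) ^ 2 * (((((ℓ + 1 : ℕ) : ℝ)) ^ (d + 1)) ^ j)⁻¹ = awPrinted ℓ j) := by
  obtain ⟨-, hpos, -, -⟩ := awPrinted_facts hℓ
  have hL : (0 : ℝ) < ((ℓ + 1 : ℕ) : ℝ) := by positivity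
  have hcast : ((ℓ : ℝ) + 1) = ((ℓ + 1 : ℕ) : ℝ) := by push_cast; ring
  refine ⟨fun j => ?_, fun j => ?_, fun j => ?_⟩
  · unfold wPrinted levC
    have := hpos j
    positivity
  · unfold wPrinted
    have hne : (((((ℓ + 1 : ℕ) : ℝ) ^ (d + 1))) ^ j) ^ 2 ≠ 0 := by positivity
    rw [inv_pow, inv_pow, mul_assoc, mul_inv_cancel₀ hne, mul_one]
  · unfold wPrinted levC
    rw [hcast]
    have hη2 : η ^ 2 ≠ 0 := by positivity
    field_simp
    ring

/-! ## §2 REAL-1 with the printed weights: no weight hypothesis left -/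

open Classical in
/-- **(1.101) ON THE CUBE MEMBER WITH THE PRINTED WEIGHTS — THE CONSUMER'S REAL-1 FAMILY WITH NO WEIGHT HYPOTHESIS LEFT**: F4d's `ineq1101_cubeMember_real` at
`a := awPrinted ℓ` (p21's printed sequence completed by `a₀ = 8`), `c := 8`, `w := wPrinted d ℓ η`.  What remains displayed is print's: `η > 0`; the big-block
size `M_h ≥ 3` with `M₀ ≤ L·M_h`; the cube datum on the big-block sub-lattice (`M_hL ∣ ρ`, `M_hL ∣ M`) with collar `ρ = R₁M₁ ≥ R·M_hL`, `2L ≤ R`, `N₀ + 1 ≤ R·L·M_h`,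
`ρ ≥ ρ₀(d, L)` («R₁, M₁ are smallest integers for which all the theorems of the papers [2, 4] are valid»); the consumer's explicit matrix at these weights.
[cite: Balaban1985RegularSpaces, (1.101) p.93, p.98, (1.131) p.99; Balaban1985BackgroundPropagators, Theorem 3.1 (3.42) p.397; Balaban1984PropagatorsII, (2.14) p.225, Prop. 2.2 (2.67) p.234] -/
theorem ineq1101_cubeMember_real_printed (d ℓ : ℕ) (hℓ : 1 ≤ ℓ) :
    ∃ BG ρ₀ M₀ : ℝ, ∃ N₀ : ℕ, 0 < BG ∧ 0 < M₀ ∧ 0 < N₀ ∧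
      ∀ (η : ℝ), 0 < η → ∀ (Mh : ℕ), 3 ≤ Mh → M₀ ≤ ((ℓ : ℝ) + 1) * Mh →
      ∀ (a : Fin (d + 1) → ℤ) (M ρ k n R : ℕ), 1 ≤ n → n ≤ k → Mh * (ℓ + 1) ∣ ρ → Mh * (ℓ + 1) ∣ M → 0 < ρ →
        R * (Mh * (ℓ + 1)) ≤ ρ → 2 * (ℓ + 1) ≤ R → N₀ + 1 ≤ R * ((ℓ + 1) * Mh) → ρ₀ ≤ (ρ : ℝ) →
      ∀ (S : Finset (Fin (d + 1) → ℤ)), (∀ z, z ∈ S ↔ z ∈ cubeFam false (ℓ + 1) a M ρ k 0) →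
      ∀ (K : (Fin (d + 1) → ℤ) → (Fin (d + 1) → ℤ) → ℝ), (∀ x z, K x z =
          ((η ^ 2)⁻¹ * ∑ μ : Fin (d + 1), ((2 : ℝ) * (if z = x then (1 : ℝ) else 0) - (if z = x + e μ then (1 : ℝ) else 0)
            - (if z = x - e μ then (1 : ℝ) else 0))) +
          (∑ j ∈ Finset.range (n + 1), (if blockMap ((ℓ + 1) ^ j) x ∈ cubeLamS (ℓ + 1) a M ρ k n j ∧
              blockMap ((ℓ + 1) ^ j) z = blockMap ((ℓ + 1) ^ j) x then
            wPrinted d ℓ η j * (((((ℓ + 1 : ℕ) : ℝ) ^ (d + 1))⁻¹) ^ j) ^ 2 else 0))) →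
      ∀ (T : Matrix ↥S ↥S ℝ), T = Matrix.of (fun x z : ↥S => K x.1 z.1) →
      ∀ (ρ' : ↥S → ℝ) (r : ℝ), 0 ≤ r →
        (∀ j, j ≤ n → ∀ z : ↥S, z.1 ∈ cubeFam false (ℓ + 1) a M ρ k j → wt (ℓ + 1) η j ^ 2 * |ρ' z| ≤ r) →
        ∀ φ : (Fin (d + 1) → ℤ) → ℝ, (∀ x, x ∉ cubeFam false (ℓ + 1) a M ρ k 0 → φ x = 0) →
          (∀ v : ↥S, φ v.1 = ∑ z : ↥S, T⁻¹ v z * ρ' z) →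
          (∀ x, |φ x| ≤ BG * r) ∧
          ∀ j, j ≤ n → ∀ p ∈ {b : (Fin (d + 1) → ℤ) × Fin (d + 1) | SideTouches (cubeFam false (ℓ + 1) a M ρ k j) b.1 b.2},
            wt (ℓ + 1) η j * |η⁻¹ * (φ (p.1 + e p.2) - φ p.1)| ≤ BG * r := by
  obtain ⟨BG, ρ₀, M₀, N₀, hBG, hM₀, hN₀, h⟩ := ineq1101_cubeMember_real d ℓ hℓ
  refine ⟨BG, ρ₀, M₀, N₀, hBG, hM₀, hN₀, ?_⟩
  intro η hη Mh hMh hM0 a M ρ k n R hn hnk hρd hMd hρ0 hR hR2 hRN hρbig S hS K hK T hT ρ' r hr hρ' φ hφ0 hφ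
  obtain ⟨hwin, hpos, -, hrec⟩ := awPrinted_facts hℓ
  obtain ⟨hwpos, hrel, hwwin⟩ := wPrinted_facts d hℓ hη
  exact h η hη Mh hMh hM0 a M ρ k n R hn hnk hρd hMd hρ0 hR hR2 hRN hρbig (awPrinted ℓ) (fun _ => 8) hwin
    (fun _ _ => by norm_num) (fun i hi => hrec i hi) hpos (wPrinted d ℓ η) hwpos (fun j _ _ => hrel j)
    (fun j hj => by
      rw [hwwin j]
      rcases Nat.eq_zero_or_pos j with h0 | hp
      · subst h0; norm_num [awPrinted]
      · exact hwin j hp)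
    S hS K hK T hT ρ' r hr hρ' φ hφ0 hφ

/-! ## §3 (v1.1) The side conditions on the data are jointly satisfiable -/

/-- **NON-VACUITY OF THE DATA OF `ineq1101_cubeMember_real_printed`**: for every `ℓ` and every thresholds `M₀, ρ₀, N₀` there are `M_h, R, ρ, M` with
`3 ≤ M_h`, `M₀ ≤ L·M_h`, `M_hL ∣ ρ`, `M_hL ∣ M`, `0 < ρ`, `R·M_hL ≤ ρ`, `2L ≤ R`, `N₀ + 1 ≤ R·L·M_h`, `ρ₀ ≤ ρ`, and the cube member's own `L ≤ ρ ≤ M`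
(witness: `M_h = max 3 ⌈M₀⌉`, `R = max 2L (N₀+1)`, `ρ = M = R·M_hL·(⌈ρ₀⌉ + 1)`) — print's «R₁, M₁ smallest integers for which all the theorems of [2, 4] are valid»,
«M a multiple of R₁M₁» are consistent requirements. [cite: Balaban1985RegularSpaces, p.98; Balaban1984PropagatorsII, (2.1)–(2.2) p.224] -/
theorem admissibleData_exists (ℓ : ℕ) (M₀ ρ₀ : ℝ) (N₀ : ℕ) :
    ∃ Mh R ρ M : ℕ, 3 ≤ Mh ∧ M₀ ≤ ((ℓ : ℝ) + 1) * Mh ∧ Mh * (ℓ + 1) ∣ ρ ∧ Mh * (ℓ + 1) ∣ M ∧ 0 < ρ ∧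
      R * (Mh * (ℓ + 1)) ≤ ρ ∧ 2 * (ℓ + 1) ≤ R ∧ N₀ + 1 ≤ R * ((ℓ + 1) * Mh) ∧ ρ₀ ≤ (ρ : ℝ) ∧ ℓ + 1 ≤ ρ ∧ ρ ≤ M := by
  set Mh : ℕ := max 3 (Nat.ceil M₀) with hMh
  set R : ℕ := max (2 * (ℓ + 1)) (N₀ + 1) with hR
  set ρ : ℕ := R * (Mh * (ℓ + 1)) * (Nat.ceil ρ₀ + 1) with hρ
  have hMh3 : 3 ≤ Mh := le_max_left _ _
  have hR2 : 2 * (ℓ + 1) ≤ R := le_max_left _ _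
  have hR1 : 1 ≤ R := le_trans (by omega) hR2
  have hbase : 1 ≤ R * (Mh * (ℓ + 1)) := Nat.mul_pos hR1 (Nat.mul_pos (by omega) (Nat.succ_pos ℓ))
  refine ⟨Mh, R, ρ, ρ, hMh3, ?_, ?_, ?_, ?_, ?_, hR2, ?_, ?_, ?_, le_rfl⟩
  · calc M₀ ≤ Nat.ceil M₀ := Nat.le_ceil M₀
      _ ≤ (Mh : ℝ) := by exact_mod_cast le_max_right 3 (Nat.ceil M₀)
      _ = 1 * (Mh : ℝ) := (one_mul _).symm
      _ ≤ ((ℓ : ℝ) + 1) * Mh := by gcongr; linarith [Nat.cast_nonneg (α := ℝ) ℓ]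
  · exact ⟨R * (Nat.ceil ρ₀ + 1), by rw [hρ]; ring⟩
  · exact ⟨R * (Nat.ceil ρ₀ + 1), by rw [hρ]; ring⟩
  · rw [hρ]; exact Nat.mul_pos hbase (Nat.succ_pos _)
  · rw [hρ]; exact Nat.le_mul_of_pos_right _ (Nat.succ_pos _)
  · calc N₀ + 1 ≤ R := le_max_right _ _
      _ = R * 1 := (mul_one _).symm
      _ ≤ R * ((ℓ + 1) * Mh) := Nat.mul_le_mul_left _ (Nat.mul_pos (Nat.succ_pos ℓ) (by omega))
  · have h1 : (ρ₀ : ℝ) ≤ Nat.ceil ρ₀ := Nat.le_ceil ρ₀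
    have h2 : ((Nat.ceil ρ₀ : ℕ) : ℝ) ≤ ((Nat.ceil ρ₀ + 1 : ℕ) : ℝ) := by exact_mod_cast Nat.le_succ _
    have h3 : ((Nat.ceil ρ₀ + 1 : ℕ) : ℝ) ≤ (ρ : ℝ) := by
      rw [hρ]; exact_mod_cast Nat.le_mul_of_pos_left _ hbase
    linarith
  · rw [hρ]
    calc ℓ + 1 ≤ Mh * (ℓ + 1) := Nat.le_mul_of_pos_left _ (by omega)
      _ ≤ R * (Mh * (ℓ + 1)) := Nat.le_mul_of_pos_left _ hR1
      _ ≤ R * (Mh * (ℓ + 1)) * (Nat.ceil ρ₀ + 1) := Nat.le_mul_of_pos_right _ (Nat.succ_pos _)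

end Literature.MathematicalPhysics.QuantumFieldTheory.Balaban1983to89.B8Eq1101CubeMemberWeights
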